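import Summits.NavierStokesRegularity.NavierStokesRegularity.Theorems.ScenarioCensusForwardSymmetry
import Literature.Analysis.FluidPDE.NSLerayHopfSereginProfileDischarges
import Literature.Analysis.FunctionSpaces.TestPairingLimits
import Literature.Analysis.FunctionSpaces.WeakL3Compactness
import Literature.Analysis.FluidPDE.NSCriticalClosureBesovKatoClass
import Literature.Analysis.FluidPDE.KatoLocalCovariance
import Literature.Analysis.FluidPDE.ClassicalEarlyWindowBound
import Literature.Analysis.FluidPDE.AxisymmetricReflection
import Literature.Analysis.FluidPDE.KatoSymmetryCovariance
import HarnessLib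

/-!
# Scenario census, rows F13m / F13mL / F13dL — profile rigidity at diverging symmetry order:
# part 1/6: vocabulary (`IsCyclicEquivariantAbout`, `IsMirrorEquivariantAbout`,
# a.e. axisymmetry / mirror symmetry, `axisCentre`), geometry of the normalising map, S1ᴰ `normalisedBadSequenceD`

Port of the ideator's tree-ready kit (ns-idea-9 g6, LINE 14 «dihedral_noswirl» REV 7 025308a3fa185027; kit file 1
`pub/ideators/ns-idea-9/lines/dihedral_noswirl/landing/ScenarioCensusLargeOrderRigidity.lean`, sha16 9e20ac97d4307bb6, 1417 l., its
declarations identical in REV 6/7; ref g7 PRE-CHECK ✓ §12.34, critic idea-crit-8 V56/V57/V58 PASS) by typer seat ns-census-typer-2 g8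
(lead g8 GO 2026-08-28T18:02Z; census FROZEN v1.62 — sub-row F13dL flips to TREE on port ACCEPT + ref CHECK), split for the
400-line rule into SIX modules `ScenarioCensusLargeOrderRigidity{Vocab, Statements, P, Geom, V}` → `ScenarioCensusLargeOrderRigidity`
(this last name is the kit's, so that kit file 2 `ScenarioCensusRowF13dLargeL3.lean` — ported by typer-1 g5 — imports it unchanged).
Declarations VERBATIM in the kit's namespace `…Theorems.ScenarioCensus.LargeOrderRigidity`; the only edits: the kit's
`local notation "ℝ³"` is replaced by the abbreviation `R3` (typer lint: no notation in ported files) and one-line docstrings are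
added to undocumented auxiliaries.

No census ROW value and no summit statement is proved in this file; `Row_F13mLarge` stays OPEN.
-/

noncomputable section

set_option linter.dupNamespace false
set_option linter.unusedVariables false

open Set Function Filter Topology MeasureTheory Metric TopologicalSpace
open scoped NNReal ENNReal RealInnerProductSpace

namespace Summit.NavierStokesRegularity.NavierStokesRegularity.Theorems.ScenarioCensus.LargeOrderRigidity

open Literature.Analysis Literature.Analysis.FluidPDE
open Summit.NavierStokesRegularity.NavierStokesRegularity.Theorems.ScenarioCensus

/-- `ℝ³` as an abbreviation (the kit's local notation). -/
abbrev R3 := EuclideanSpace ℝ (Fin 3)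

/-! ## Vocabulary -/

/-- `C_m`-equivariance of a field about the vertical axis through `c`:
`a (c + R_{2π/m}(y - c)) = R_{2π/m} (a y)`.  For `c = 0` this is Row F13m's datum hypothesis. -/
def IsCyclicEquivariantAbout (m : ℕ) (c : R3) (a : R3 → R3) : Prop :=
  ∀ y : R3, a (c + rotZ (2 * Real.pi / m) (y - c)) = rotZ (2 * Real.pi / m) (a y)

/-- Mirror-equivariance of a field in the vertical plane through `c` parallel to `{x₁ = 0}`:
`a (c + σ (y - c)) = σ (a y)`, `σ = reflY`.  For `c = 0` this is the cell's mirror clause. -/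
def IsMirrorEquivariantAbout (c : R3) (a : R3 → R3) : Prop :=
  ∀ y : R3, a (c + reflY (y - c)) = reflY (a y)

/-- a.e.-axisymmetry of an `L¹_loc` field about the vertical axis through `ξ`: for every angle `θ`,
`a (ξ + R_θ x) = R_θ (a (ξ + x))` for a.e. `x` (the form in which symmetry survives weak limits). -/
def IsAEAxisymmetricAbout (ξ : R3) (a : R3 → R3) : Prop :=
  ∀ θ : ℝ, (fun x : R3 => a (ξ + rotZ θ x)) =ᵐ[volume] fun x : R3 => rotZ θ (a (ξ + x))

/-- a.e.-mirror symmetry of an `L¹_loc` field in the vertical plane through `ξ` parallel to `{x₁ = 0}`: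
`a (ξ + σ x) = σ (a (ξ + x))` for a.e. `x`.  For an a.e.-axisymmetric field about the axis through `ξ`
this says the field has NO SWIRL a.e. (pointwise version: `mirror_iff_hasNoSwirl`). -/
def IsAEMirrorSymmetricAbout (ξ : R3) (a : R3 → R3) : Prop :=
  (fun x : R3 => a (ξ + reflY x)) =ᵐ[volume] fun x : R3 => reflY (a (ξ + x))

/-! ## Geometry of the normalising map -/

/-- Rotations about the axis are linear: `R_θ (c v) = c R_θ v`. [folklore] -/
theorem rotZ_smul' (θ c : ℝ) (v : R3) : rotZ θ (c • v) = c • rotZ θ v := by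
  ext i
  fin_cases i <;> simp [rotZ, PiLp.toLp_apply] <;> ring

/-- The horizontal centre `c = -x^h/λ` of the symmetry axis after the normalisation
`y ↦ λ y + x` (`λ > 0`): the vertical line through `c` is the preimage of the `x₃`-axis. -/
def axisCentre (lam : ℝ) (x : R3) : R3 := WithLp.toLp 2 ![-(x 0) / lam, -(x 1) / lam, 0]

/-- Auxiliary step of LINE 14 «dihedral_noswirl» (`axisCentre_apply_zero`), ported verbatim. -/
@[simp] theorem axisCentre_apply_zero (lam : ℝ) (x : R3) : axisCentre lam x 0 = -(x 0) / lam := rfl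
/-- Auxiliary step of LINE 14 «dihedral_noswirl» (`axisCentre_apply_one`), ported verbatim. -/
@[simp] theorem axisCentre_apply_one (lam : ℝ) (x : R3) : axisCentre lam x 1 = -(x 1) / lam := rfl
/-- Auxiliary step of LINE 14 «dihedral_noswirl» (`axisCentre_apply_two`), ported verbatim. -/
@[simp] theorem axisCentre_apply_two (lam : ℝ) (x : R3) : axisCentre lam x 2 = 0 := rfl

/-- **Conjugation identity**: the normalising map `y ↦ λ y + x` intertwines the rotation by `θ` about the
vertical axis through `axisCentre λ x` with the rotation by `θ` about the `x₃`-axis. [folklore] -/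
theorem normalise_conj_rotZ {lam : ℝ} (hlam : lam ≠ 0) (x y : R3) (θ : ℝ) :
    lam • (axisCentre lam x + rotZ θ (y - axisCentre lam x)) - -x = rotZ θ (lam • y - -x) := by
  ext i
  fin_cases i <;> simp [rotZ, PiLp.toLp_apply] <;> field_simp <;> ring

/-- Backward cylinders at `(1, 0)` of radius `r ≤ 1`... precisely `r² < 1`, lie in the strip
`(0, 1) × R3`. [folklore] -/
theorem parabolicCylinder_one_subset_strip {r : ℝ} (hr : r ^ 2 < 1) :
    parabolicCylinder r ((1 : ℝ), (0 : R3)) ⊆ Ioo (0 : ℝ) 1 ×ˢ (univ : Set R3) := by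
  rintro ⟨t, z⟩ hz
  simp only [parabolicCylinder, mem_prod, mem_Ioo] at hz
  exact ⟨⟨by linarith [hz.1.1], hz.1.2⟩, mem_univ _⟩

/-- `R_θ 0 = 0`. [folklore] -/
theorem rotZ_zero_vec (θ : ℝ) : rotZ θ (0 : R3) = 0 := by
  ext i; fin_cases i <;> simp [rotZ]

/-- The zero field is a.e.-axisymmetric about every axis (the endpoint of cases (ii)/(iii) of S2). -/
theorem isAEAxisymmetricAbout_zero (ξ : R3) : IsAEAxisymmetricAbout ξ (fun _ => 0) := by
  intro θ
  show (fun _ : R3 => (0 : R3)) =ᵐ[volume] fun _ : R3 => rotZ θ (0 : R3)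
  rw [rotZ_zero_vec]

/-- An a.e.-modification of an a.e.-axisymmetric field is a.e.-axisymmetric (the notion is a property of
the `L³` class, as it must be for weak limits). -/
theorem IsAEAxisymmetricAbout.congr_ae {ξ : R3} {a b : R3 → R3} (ha : IsAEAxisymmetricAbout ξ a)
    (hab : a =ᵐ[volume] b) : IsAEAxisymmetricAbout ξ b := by
  intro θ
  -- the affine isometries `x ↦ ξ + R_θ x` and `x ↦ ξ + x` are measure preserving
  have h1 : (fun x : R3 => a (ξ + rotZ θ x)) =ᵐ[volume] fun x => b (ξ + rotZ θ x) := by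
    have hmp : MeasurePreserving (fun x : R3 => ξ + rotZ θ x) volume volume :=
      (measurePreserving_add_left volume ξ).comp (rotZLIE θ).measurePreserving
    exact hmp.quasiMeasurePreserving.ae_eq_comp hab
  have h2 : (fun x : R3 => rotZ θ (a (ξ + x))) =ᵐ[volume] fun x => rotZ θ (b (ξ + x)) := by
    have hmp : MeasurePreserving (fun x : R3 => ξ + x) volume volume := measurePreserving_add_left volume ξ
    filter_upwards [hmp.quasiMeasurePreserving.ae_eq_comp hab] with x hx
    simp only [Function.comp] at hx ⊢
    rw [hx]
  exact (h1.symm.trans (ha θ)).trans h2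

/-- **Conjugation identity for the mirror**: the normalising map `y ↦ λ y + x` intertwines the reflection
in the vertical plane through `axisCentre λ x` parallel to `{x₁ = 0}` with `σ = reflY` itself
(translations and dilations do not rotate the mirror plane). [folklore] -/
theorem normalise_conj_reflY {lam : ℝ} (hlam : lam ≠ 0) (x y : R3) :
    lam • (axisCentre lam x + reflY (y - axisCentre lam x)) - -x = reflY (lam • y - -x) := by
  ext i
  fin_cases i <;> simp <;> field_simp <;> ring

/-- The zero field is a.e.-mirror-symmetric about every centre. -/
theorem isAEMirrorSymmetricAbout_zero (ξ : R3) : IsAEMirrorSymmetricAbout ξ (fun _ => 0) := by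
  show (fun _ : R3 => (0 : R3)) =ᵐ[volume] fun _ : R3 => reflY (0 : R3)
  rw [map_zero]

/-- An a.e.-modification of an a.e.-mirror-symmetric field is a.e.-mirror-symmetric. -/
theorem IsAEMirrorSymmetricAbout.congr_ae {ξ : R3} {a b : R3 → R3} (ha : IsAEMirrorSymmetricAbout ξ a)
    (hab : a =ᵐ[volume] b) : IsAEMirrorSymmetricAbout ξ b := by
  have h1 : (fun x : R3 => a (ξ + reflY x)) =ᵐ[volume] fun x => b (ξ + reflY x) := by
    have hmp : MeasurePreserving (fun x : R3 => ξ + reflY x) volume volume :=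
      (measurePreserving_add_left volume ξ).comp reflY.measurePreserving
    exact hmp.quasiMeasurePreserving.ae_eq_comp hab
  have h2 : (fun x : R3 => reflY (a (ξ + x))) =ᵐ[volume] fun x => reflY (b (ξ + x)) := by
    have hmp : MeasurePreserving (fun x : R3 => ξ + x) volume volume := measurePreserving_add_left volume ξ
    filter_upwards [hmp.quasiMeasurePreserving.ae_eq_comp hab] with x hx
    simp only [Function.comp] at hx ⊢
    rw [hx]
  exact (h1.symm.trans ha).trans h2

/-! ## S1ᴰ — the normalised bad sequence with mirror (PROVED) -/

/-- **S1ᴰ (GLUE — normalised bad sequence; PROVED from tree theorems).**  If the cell fails at `(ν, K)`, there are orders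
`m_j → ∞`, horizontal centres `c_j`, data `a_j ∈ L³` (weakly divergence free, `‖a_j‖₃ ≤ Kν`,
`C_{m_j}`-equivariant about the vertical axis through `c_j` AND mirror-equivariant in the parallel vertical plane through
`c_j`) and local Leray solutions `(w_j, q_j) ∈ 𝒩(a_j)`
each essentially unbounded on every backward cylinder at `(1, 0)`.  Every ingredient is a tree theorem:
choice of a bad solution at order `m_j ≥ j`; `isKatoSolutionOn_of_classical`;
`exists_singularPoint_of_classical_of_not_hasSmoothExtensionPast` (singular point `(T_j, x_j)`);
`kato_local_rescale_translate` with `λ_j = √T_j`, `x₀ = -x_j` (singular point ↦ `(1, 0)`, axis ↦ the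
vertical line through `c_j = -x_j^h/λ_j`, `L³` norm unchanged: `eLpNorm_three_rescaleData`);
`eLpNorm_top_uncurry_rescale_translate` (singular cylinders transported);
`leray_solution_exists_ae_eq_kato_holds` (a local Leray solution a.e. equal to the Kato solution on
`(0, 1) × R3`, hence singular at `(1, 0)`: `eLpNorm_top_parabolicCylinder_eq_top_of_small`). -/
theorem normalisedBadSequenceD {ν K : ℝ} (hν : 0 < ν)
    (hbad : ∀ m₀ : ℕ, ∃ m : ℕ, m₀ ≤ m ∧ ∃ T : ℝ, 0 < T ∧
      ∃ (u : ℝ → R3 → R3) (p : ℝ → R3 → ℝ),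
        IsClassicalNSSolutionOn (Ico 0 T) ν 0 u p ∧ IsLerayHopfOn T ν 0 (u 0) u ∧
        HasRapidSpatialDecay (u 0) ∧
        (∀ x : R3, u 0 (rotZ (2 * Real.pi / m) x) = rotZ (2 * Real.pi / m) (u 0 x)) ∧
        (∀ x : R3, u 0 (reflY x) = reflY (u 0 x)) ∧
        eLpNorm (u 0) 3 volume ≤ ENNReal.ofReal (K * ν) ∧ ¬ HasSmoothExtensionPast ν 0 u T) :
    ∃ (m : ℕ → ℕ) (c : ℕ → R3) (a : ℕ → R3 → R3) (w : ℕ → ℝ → R3 → R3) (q : ℕ → ℝ → R3 → ℝ),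
      Tendsto m atTop atTop ∧ (∀ j, c j 2 = 0) ∧
      (∀ j, MemLp (a j) 3 volume ∧ IsWeaklyDivFree (a j) ∧
        eLpNorm (a j) 3 volume ≤ ((K * ν).toNNReal : ℝ≥0∞)) ∧
      (∀ j, IsLocalLeraySolution ν (a j) (w j) (q j)) ∧
      (∀ j, IsCyclicEquivariantAbout (m j) (c j) (a j)) ∧
      (∀ j, IsMirrorEquivariantAbout (c j) (a j)) ∧
      (∀ j (r : ℝ), 0 < r →
        eLpNorm (uncurry (w j)) ∞ (volume.restrict (parabolicCylinder r ((1 : ℝ), (0 : R3)))) = ∞) := by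
  classical
  -- bad solutions at orders `m_j ≥ j`
  choose m hm T hT u p hcl hLH hdec hsym hmir hbud hext using hbad
  -- they are Kato solutions with a singular point `(T_j, x_j)`
  have hK : ∀ j, IsKatoSolutionOn (T j) ν (u j 0) (u j) := fun j =>
    isKatoSolutionOn_of_classical hν (hT j) (hcl j) (hLH j) (hdec j)
  have hsingT : ∀ j, ∃ x₀ : R3, ∀ r : ℝ, 0 < r →
      eLpNorm (uncurry (u j)) ∞ (volume.restrict (parabolicCylinder r ((T j : ℝ), x₀))) = ∞ := by
    intro j
    obtain ⟨x₀, hx₀⟩ := exists_singularPoint_of_classical_of_not_hasSmoothExtensionPast hν (hT j)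
      (hcl j) (hLH j) (hdec j) (hext j)
    exact ⟨x₀, fun r hr => eLpNorm_top_parabolicCylinder_eq_top_of_small (hT j) hx₀ hr⟩
  choose x hx using hsingT
  -- scales `λ_j = √T_j`
  set lam : ℕ → ℝ := fun j => Real.sqrt (T j) with hlam_def
  have hlam : ∀ j, 0 < lam j := fun j => Real.sqrt_pos.2 (hT j)
  have hlam2 : ∀ j, lam j ^ 2 = T j := fun j => Real.sq_sqrt (hT j).le
  -- normalised data and Kato solutions on `[0, 1)`
  set a : ℕ → R3 → R3 := fun j => rescaleData (lam j) fun y => u j 0 (y - -x j) with ha_def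
  set v : ℕ → ℝ → R3 → R3 := fun j t y => lam j • u j (lam j ^ 2 * t) (lam j • y - -x j) with hv_def
  have hK1 : ∀ j, IsKatoSolutionOn 1 ν (a j) (v j) := by
    intro j
    obtain ⟨h1, h2, h3, h4⟩ := kato_local_rescale_translate (hK j).mild (hK j).continuousInLpOn
      (hK j).initial (hK j).aestronglyMeasurable (hlam j) (-x j)
    have h1T : T j / lam j ^ 2 = 1 := by rw [hlam2, div_self (hT j).ne']
    rw [h1T] at h1 h2 h4
    exact ⟨h1, h2, h3, h4⟩
  have ha3 : ∀ j, MemLp (a j) 3 volume := fun j => by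
    have h := (hK1 j).memLp (t := 0) ⟨le_rfl, one_pos⟩
    rwa [(hK1 j).initial] at h
  have hdiv : ∀ j, IsWeaklyDivFree (a j) := fun j => by
    have h := (hK1 j).mild.1 0 ⟨le_rfl, one_pos⟩
    rwa [(hK1 j).initial] at h
  have hnorm : ∀ j, eLpNorm (a j) 3 volume ≤ ((K * ν).toNNReal : ℝ≥0∞) := fun j => by
    have hmeas : AEStronglyMeasurable (u j 0) volume := ((hLH j).memLp 0 ⟨le_rfl, (hT j).le⟩).1
    have e1 : eLpNorm (a j) 3 volume = eLpNorm (fun y => u j 0 (y - -x j)) 3 volume :=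
      eLpNorm_three_rescaleData _ (hlam j)
    have e2 : eLpNorm (fun y => u j 0 (y - -x j)) 3 volume = eLpNorm (u j 0) 3 volume :=
      eLpNorm_comp_measurePreserving (g := u j 0) (f := fun y : R3 => y - -x j) hmeas
        (measurePreserving_sub_right volume (-x j))
    rw [e1, e2]
    exact hbud j
  -- local Leray solutions a.e. equal to the normalised Kato solutions on `(0, 1) × R3`
  have hLer : ∀ j, ∃ (w : ℝ → R3 → R3) (q : ℝ → R3 → ℝ), IsLocalLeraySolution ν (a j) w q ∧
      uncurry w =ᵐ[volume.restrict (Ioo 0 1 ×ˢ (univ : Set R3))] uncurry (v j) := fun j =>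
    leray_solution_exists_ae_eq_kato_holds hν one_pos (ha3 j) (hdiv j) (hK1 j)
  choose w q hw hae using hLer
  -- the normalised Kato solutions are singular at `(1, 0)`
  have hvsing : ∀ j (r : ℝ), 0 < r →
      eLpNorm (uncurry (v j)) ∞ (volume.restrict (parabolicCylinder r ((1 : ℝ), (0 : R3)))) = ∞ := by
    intro j r hr
    have h := eLpNorm_top_uncurry_rescale_translate (u j) (hlam j) (-x j) r 1 0
    have e1 : (lam j ^ 2 * 1 : ℝ) = T j := by rw [mul_one, hlam2]
    have e2 : lam j • (0 : R3) - -x j = x j := by rw [smul_zero, sub_neg_eq_add, zero_add]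
    rw [e1, e2, hx j (lam j * r) (mul_pos (hlam j) hr),
      ENNReal.mul_top (enorm_ne_zero.2 (hlam j).ne')] at h
    exact h
  -- hence so are the local Leray solutions
  have hwsing : ∀ j (r : ℝ), 0 < r →
      eLpNorm (uncurry (w j)) ∞ (volume.restrict (parabolicCylinder r ((1 : ℝ), (0 : R3)))) = ∞ := by
    intro j r hr
    refine eLpNorm_top_parabolicCylinder_eq_top_of_small one_pos (fun ρ hρ hρ1 => ?_) hr
    rw [eLpNorm_congr_ae (ae_restrict_of_ae_restrict_of_subset
      (parabolicCylinder_one_subset_strip hρ1) (hae j))]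
    exact hvsing j ρ hρ
  -- the package
  refine ⟨m, fun j => axisCentre (lam j) (x j), a, w, q, ?_, fun j => rfl, fun j =>
    ⟨ha3 j, hdiv j, hnorm j⟩, hw, fun j => ?_, fun j => ?_, hwsing⟩
  · exact tendsto_atTop_atTop.2 fun b => ⟨b, fun j hj => le_trans hj (hm j)⟩
  · -- equivariance about the moved axis
    intro y
    show lam j • u j 0 (lam j • (axisCentre (lam j) (x j) +
        rotZ (2 * Real.pi / m j) (y - axisCentre (lam j) (x j))) - -x j) =
      rotZ (2 * Real.pi / m j) (lam j • u j 0 (lam j • y - -x j))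
    rw [normalise_conj_rotZ (hlam j).ne', hsym j, rotZ_smul']
  · -- mirror-equivariance about the moved plane
    intro y
    show lam j • u j 0 (lam j • (axisCentre (lam j) (x j) +
        reflY (y - axisCentre (lam j) (x j))) - -x j) =
      reflY (lam j • u j 0 (lam j • y - -x j))
    rw [normalise_conj_reflY (hlam j).ne', hmir j, map_smul]

end Summit.NavierStokesRegularity.NavierStokesRegularity.Theorems.ScenarioCensus.LargeOrderRigidity

end
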